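import Summits.Ventures.LatticeQCDFlow.Scaling.DominatedStarMixingCeiling

/-!
HONEST FRAMING: exact (Metropolis-corrected) sampling algorithms for lattice gauge theory; figures
of merit are autocorrelation/cost numbers at stated couplings and volumes; no continuum-physics
claim.

# DominatedStarSeparation — THE SEPARATION CEILING WITHOUT PERFECT TRANSPORTS: FOR THE MAP-ASSISTED HOT-REFRESHED HUB
# UNDER ONE-SIDED DOMINATION `p·μ_l(φ_r u) ≤ μ_0(u)` AND `4t ≤ p(1−t)w_0`, `Pⁿ(x,·) ≥ (1 − ((2K+p)/p)(1 − tcp/(2m))ⁿ)·π̃`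
# FROM EVERY START, I.E. `s(n) ≤ ((2K+p)/p)(1 − tcp/(2m))ⁿ` — A WHOLE-SPACE DOEBLIN CONDITION AT THE COUPON-COLLECTOR
# TIME; WITH PERFECT TRANSPORTS `s(n) ≤ 2(K+1)(1 − t(1−t)w_0c/(2m))ⁿ` (lean-2 GEN-26, ours)

Venture-side (OURS).  Cell `lqcd-flow` (pub-lqcd), unit `pub-lqcd-lean-2-g26`, 2026-08-27.  Chapter M (the
coupon-collector ceiling without perfect transports), file 11.  Setting of `Scaling/DominatedStarMixingCeiling`: the
scheme `P = t·GSw + (1−t)·Π_w^M` on `Fin (K+1) → S` over the hub list `e_r = (0, κ_r+1)` (length `m`, every cold level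
listed `≥ c ≥ 1` times) with bijections `φ_r`, positive unit-mass laws `μ_k`, update weights `w`, the exact hot
sampler and `μ_k`-stationary cold kernels.  The minorisation `(δ_x Pⁿ)(z) ≥ P(D_n = ∅)·π̃(z)` of
`Scaling/DominatedStarMinorization` is a statement about the SEPARATION distance `s(n) = max_{x,z}(1 − Pⁿ(x,z)/π̃(z))`,
which dominates the total-variation distance and controls stopping-time constructions; this file records it in that
currency, with the tag-chain estimates of `Scaling/RegenerationTagDecay`.

## What is proved

* §0 **`sepDist_le_of_minorization`** — for any chain on a finite space with a positive target `π`: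
  `(∀ x z, a·π(z) ≤ Pⁿ(x,z))`, `a ≤ 1` ⇒ `s(n) ≤ 1 − a` (bookkeeping).
* §1 **`dominatedStar_kernelAt_ge`** — `0 < p ≤ 1`, `p·μ_{l_r}(φ_r u) ≤ μ_0(u)`, `4t ≤ p(1−t)w_0`:
  `(1 − ((2K+p)/p)(1 − tcp/(2m))ⁿ)·π̃(z) ≤ Pⁿ(x,z)`; **`dominatedStar_sepDist_le`** —
  **`s(n) ≤ ((2K+p)/p)·(1 − tcp/(2m))ⁿ`**; `dominatedStar_sepDist_le_of_ge_log` — `s(n) ≤ ε` once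
  `n ≥ (2m/(tcp))·log((2K+p)/(pε))`; `dominatedStar_worstTvDist_le_sepDist` — `d(n) ≤ s(n)` (Levin–Peres–Wilmer
  Lemma 6.16, from the tree).
* §2 **`perfectStar_kernelAt_ge`**, **`perfectStar_sepDist_le`** — perfect transports, `0 < t < 1`, `w_0 > 0`, any laws,
  maps, weights: `s(n) ≤ 2(K+1)·(1 − t(1−t)w_0c/(2m))ⁿ`; `perfectStar_sepDist_le_of_ge_log`.

Reading (no numerics implied): after `(2m/(tcp))·log((2K+p)/(pε))` steps the `n`-step law of the map-assisted hub
from ANY start carries a `(1−ε)`-fraction of the exact product law `π̃` pointwise — the form in which the regeneration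
argument is used for perfect sampling from the past or for honest error bars via split chains; the transport quality
enters through `p` only.  NOT CLAIMED: anything outside the regime `4t ≤ p(1−t)w_0` for imperfect maps; strong
stationary times are not constructed here; anything measured.  Literature grade (cell rule): OWN RESULT; the one
literature step (`d ≤ s`, Levin–Peres–Wilmer 2017 Lemma 6.16) is imported from the tree, not restated; no new bib keys.
-/

noncomputable section

open Finset Function
open Literature.Probability.MarkovChains

namespace Summit.Ventures.LatticeQCDFlow.Scaling

/-! ## §0 Separation from a pointwise minorisation -/

/-- **`(∀ x z, a·π(z) ≤ Pⁿ(x,z))` and `a ≤ 1` give `s(n) ≤ 1 − a`** for a positive target `π`. [ours] -/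
theorem sepDist_le_of_minorization {X : Type*} [Fintype X] [DecidableEq X] {P : X → X → ℝ} {π : X → ℝ}
    (hπ : ∀ z, 0 < π z) {a : ℝ} (ha : a ≤ 1) {n : ℕ} (hmin : ∀ x z, a * π z ≤ kernelAt P n x z) :
    sepDist P π n ≤ 1 - a := by
  have hb : 0 ≤ 1 - a := by linarith
  refine Real.iSup_le (fun x => Real.iSup_le (fun z => ?_) hb) hb
  have h := hmin x z
  rw [sub_le_sub_iff_left, le_div_iff₀ (hπ z)]
  exact h

variable {S : Type*} [Fintype S] [DecidableEq S] {K m : ℕ} {μ : Fin (K + 1) → S → ℝ} {M : Fin (K + 1) → S → S → ℝ}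
  {w : Fin (K + 1) → ℝ} {t p : ℝ}

section Sep
variable (κ : Fin m → Fin K) (φ : Fin m → Equiv.Perm S)

/-! ## §1 One-sided domination -/

/-- **`Pⁿ(x,z) ≥ (1 − ((2K+p)/p)(1 − tcp/(2m))ⁿ)·π̃(z)`** for the map-assisted hot-refreshed hub under one-sided
domination `p·μ_{l_r}(φ_r u) ≤ μ_0(u)` (`0 < p ≤ 1`) in the regime `4t ≤ p(1−t)w_0`, every `x`, `z`, `n`. [ours] -/
theorem dominatedStar_kernelAt_ge (hm : 1 ≤ m) (ht0 : 0 ≤ t) (ht1 : t ≤ 1) (hw0 : ∀ k, 0 ≤ w k)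
    (hw1 : ∑ k, w k = 1) (hμ : ∀ k x, 0 < μ k x) (hμ1 : ∀ k, ∑ u, μ k u = 1) (hM : ∀ k, IsRowStochastic (M k))
    (hM0 : ∀ u v, M 0 u v = μ 0 v) (hstat : ∀ k : Fin (K + 1), k ≠ 0 → ∀ v, ∑ u, μ k u * M k u v = μ k v)
    (hp0 : 0 < p) (hp1 : p ≤ 1) (hdom : ∀ r u, p * μ (κ r).succ (φ r u) ≤ μ 0 u) (hreg : 4 * t ≤ p * (1 - t) * w 0)
    {c : ℕ} (hc1 : 1 ≤ c) (hc : ∀ p' : Fin K, c ≤ (univ.filter (fun r : Fin m => κ r = p')).card) (hcm : c ≤ m)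
    (n : ℕ) (x z : Fin (K + 1) → S) :
    (1 - (2 * (K : ℝ) + p) / p * (1 - t * c * p / (2 * m)) ^ n) * tensorFun μ z
      ≤ kernelAt (fun y z : Fin (K + 1) → S =>
          t * ptGraphSwap μ (fun r : Fin m => (((0 : Fin (K + 1)), (κ r).succ) : Fin (K + 1) × Fin (K + 1))) φ y z
          + (1 - t) * prodKernel w M y z) n x z := by
  -- the hypothesis-equation objects of the chapter (reverse constant `q = 0`)
  set α : Fin m → (Fin (K + 1) → S) → ℝ :=
    fun r z => min 1 (tensorFun μ (edgeFlowSwap (φ r) 0 (κ r).succ z) / tensorFun μ z) with hα_def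
  have hα : ∀ r z, α r z = min 1 (tensorFun μ (edgeFlowSwap (φ r) 0 (κ r).succ z) / tensorFun μ z) := fun _ _ => rfl
  set β : Fin m → (Fin (K + 1) → S) → ℝ := fun r z => p * μ (κ r).succ (φ r (z 0)) / μ 0 (z 0) with hβ_def
  have hβ : ∀ r z, β r z = p * μ (κ r).succ (φ r (z 0)) / μ 0 (z 0) := fun _ _ => rfl
  set β' : Fin m → (Fin (K + 1) → S) → ℝ :=
    fun r z => (0 : ℝ) * μ 0 ((φ r).symm (z (κ r).succ)) / μ (κ r).succ (z (κ r).succ) with hβ'_def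
  have hβ' : ∀ r z, β' r z = (0 : ℝ) * μ 0 ((φ r).symm (z (κ r).succ)) / μ (κ r).succ (z (κ r).succ) :=
    fun _ _ => rfl
  set γ : Fin m → (Fin (K + 1) → S) × Finset (Fin (K + 1)) → ℝ := fun r a =>
    if (0 : Fin (K + 1)) ∉ a.2 then (if (κ r).succ ∉ a.2 then α r a.1 else β r a.1)
      else (if (κ r).succ ∉ a.2 then β' r a.1 else 0) with hγ_def
  have hγ : ∀ r a, γ r a = if (0 : Fin (K + 1)) ∉ a.2 then (if (κ r).succ ∉ a.2 then α r a.1 else β r a.1)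
      else (if (κ r).succ ∉ a.2 then β' r a.1 else 0) := fun _ _ => rfl
  set gbar : Fin m → Finset (Fin (K + 1)) → ℝ := fun r D =>
    if (0 : Fin (K + 1)) ∉ D then (if (κ r).succ ∉ D then (1 : ℝ) else p) else (if (κ r).succ ∉ D then (0 : ℝ) else 0)
    with hg_def
  have hg : ∀ r D, gbar r D = if (0 : Fin (K + 1)) ∉ D then (if (κ r).succ ∉ D then (1 : ℝ) else p)
      else (if (κ r).succ ∉ D then (0 : ℝ) else 0) := fun _ _ => rfl
  set Bset : Fin m → Finset (Fin (K + 1)) → Finset (Fin (K + 1)) := fun r D =>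
    if (0 : Fin (K + 1)) ∉ D ∧ (κ r).succ ∉ D then D else insert (0 : Fin (K + 1)) (insert (κ r).succ D) with hB_def
  have hB : ∀ r D, Bset r D = if (0 : Fin (K + 1)) ∉ D ∧ (κ r).succ ∉ D then D
      else insert (0 : Fin (K + 1)) (insert (κ r).succ D) := fun _ _ => rfl
  set Ph : (Fin (K + 1) → S) × Finset (Fin (K + 1)) → (Fin (K + 1) → S) × Finset (Fin (K + 1)) → ℝ := fun a b =>
    ∑ r : Fin m, t / m *
        (γ r a * (if b.1 = edgeFlowSwap (φ r) 0 (κ r).succ a.1 ∧ b.2 = a.2.image (Equiv.swap (0 : Fin (K + 1)) (κ r).succ)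
            then (1 : ℝ) else 0)
          + (α r a.1 - γ r a) * (if b.1 = edgeFlowSwap (φ r) 0 (κ r).succ a.1 ∧ b.2 = Bset r a.2 then (1 : ℝ) else 0)
          + (1 - α r a.1) * (if b.1 = a.1 ∧ b.2 = Bset r a.2 then (1 : ℝ) else 0))
      + (1 - t) * ∑ k : Fin (K + 1), w k * (coordKernel M k a.1 b.1
          * (if b.2 = (if k = 0 then a.2.erase 0 else a.2) then (1 : ℝ) else 0)) with hPh_def
  have hPh : ∀ a b, Ph a b = ∑ r : Fin m, t / m *
        (γ r a * (if b.1 = edgeFlowSwap (φ r) 0 (κ r).succ a.1 ∧ b.2 = a.2.image (Equiv.swap (0 : Fin (K + 1)) (κ r).succ)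
            then (1 : ℝ) else 0)
          + (α r a.1 - γ r a) * (if b.1 = edgeFlowSwap (φ r) 0 (κ r).succ a.1 ∧ b.2 = Bset r a.2 then (1 : ℝ) else 0)
          + (1 - α r a.1) * (if b.1 = a.1 ∧ b.2 = Bset r a.2 then (1 : ℝ) else 0))
      + (1 - t) * ∑ k : Fin (K + 1), w k * (coordKernel M k a.1 b.1
          * (if b.2 = (if k = 0 then a.2.erase 0 else a.2) then (1 : ℝ) else 0)) := fun _ _ => rfl
  set Q : Finset (Fin (K + 1)) → Finset (Fin (K + 1)) → ℝ := fun D D' => ∑ r : Fin m, t / m *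
        (gbar r D * (if D' = D.image (Equiv.swap (0 : Fin (K + 1)) (κ r).succ) then (1 : ℝ) else 0)
          + (1 - gbar r D) * (if D' = Bset r D then (1 : ℝ) else 0))
      + (1 - t) * (w 0 * (if D' = D.erase 0 then (1 : ℝ) else 0) + (1 - w 0) * (if D' = D then (1 : ℝ) else 0)) with hQ_def
  have hQ : ∀ D D', Q D D' = ∑ r : Fin m, t / m *
        (gbar r D * (if D' = D.image (Equiv.swap (0 : Fin (K + 1)) (κ r).succ) then (1 : ℝ) else 0)
          + (1 - gbar r D) * (if D' = Bset r D then (1 : ℝ) else 0))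
      + (1 - t) * (w 0 * (if D' = D.erase 0 then (1 : ℝ) else 0) + (1 - w 0) * (if D' = D then (1 : ℝ) else 0)) :=
    fun _ _ => rfl
  have hw00 : 0 ≤ w 0 := hw0 0
  have hw01 : w 0 ≤ 1 := by
    have h := Finset.single_le_sum (f := w) (fun k _ => hw0 k) (mem_univ (0 : Fin (K + 1)))
    rw [hw1] at h; exact h
  have hrev : ∀ r u, (0 : ℝ) * μ 0 u ≤ μ (κ r).succ (φ r u) := fun r u => by rw [zero_mul]; exact (hμ _ _).le
  -- the tag estimate and the mass identity `(δ_{univ}Qⁿ)(∅) = 1 − Σ_{D ≠ ∅}`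
  have htag := regen_nonempty_le_oneSided κ hm ht0 ht1 hw00 hw01 hp0 hp1 le_rfl zero_le_one hreg hg hB hQ hc1 hc hcm n
  have hQst := regen_isRowStochastic κ hm ht0 ht1 hw00 hw01 hp0.le hp1 le_rfl zero_le_one hg hQ
  have hmassQ : ∑ D, lawAt Q (Pi.single (univ : Finset (Fin (K + 1))) 1) n D = 1 := by
    rw [sum_lawAt hQst, Finset.sum_pi_single', if_pos (mem_univ _)]
  have hsplit := Finset.sum_filter_add_sum_filter_not univ (fun D : Finset (Fin (K + 1)) => D ≠ ∅)
    (fun D => lawAt Q (Pi.single (univ : Finset (Fin (K + 1))) 1) n D)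
  have hE : univ.filter (fun D : Finset (Fin (K + 1)) => ¬D ≠ ∅) = {∅} := by
    ext D; simp only [Finset.mem_filter, Finset.mem_univ, true_and, not_not, Finset.mem_singleton]
  rw [hmassQ, hE, Finset.sum_singleton] at hsplit
  have hmin := dom_minorization κ φ hm ht0 ht1 hw0 hw1 hμ hμ1 hM hM0 hstat hp0.le le_rfl hdom hrev hα hβ hβ' hγ hg hB
    hPh hQ x n z
  have hπ0 : 0 ≤ tensorFun μ z := (tensorFun_pos hμ z).le
  unfold kernelAt
  calc (1 - (2 * (K : ℝ) + p) / p * (1 - t * c * p / (2 * m)) ^ n) * tensorFun μ z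
      ≤ lawAt Q (Pi.single (univ : Finset (Fin (K + 1))) 1) n ∅ * tensorFun μ z :=
        mul_le_mul_of_nonneg_right (by linarith) hπ0
    _ ≤ _ := hmin

/-- **THE SEPARATION CEILING WITHOUT PERFECT TRANSPORTS: `s(n) ≤ ((2K+p)/p)·(1 − tcp/(2m))ⁿ`** under one-sided
domination and `4t ≤ p(1−t)w_0`. [ours] -/
theorem dominatedStar_sepDist_le (hm : 1 ≤ m) (ht0 : 0 ≤ t) (ht1 : t ≤ 1) (hw0 : ∀ k, 0 ≤ w k)
    (hw1 : ∑ k, w k = 1) (hμ : ∀ k x, 0 < μ k x) (hμ1 : ∀ k, ∑ u, μ k u = 1) (hM : ∀ k, IsRowStochastic (M k))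
    (hM0 : ∀ u v, M 0 u v = μ 0 v) (hstat : ∀ k : Fin (K + 1), k ≠ 0 → ∀ v, ∑ u, μ k u * M k u v = μ k v)
    (hp0 : 0 < p) (hp1 : p ≤ 1) (hdom : ∀ r u, p * μ (κ r).succ (φ r u) ≤ μ 0 u) (hreg : 4 * t ≤ p * (1 - t) * w 0)
    {c : ℕ} (hc1 : 1 ≤ c) (hc : ∀ p' : Fin K, c ≤ (univ.filter (fun r : Fin m => κ r = p')).card) (hcm : c ≤ m)
    (n : ℕ) :
    sepDist (fun y z : Fin (K + 1) → S =>
          t * ptGraphSwap μ (fun r : Fin m => (((0 : Fin (K + 1)), (κ r).succ) : Fin (K + 1) × Fin (K + 1))) φ y z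
          + (1 - t) * prodKernel w M y z) (tensorFun μ) n
      ≤ (2 * (K : ℝ) + p) / p * (1 - t * c * p / (2 * m)) ^ n := by
  have hbound : 0 ≤ (2 * (K : ℝ) + p) / p * (1 - t * c * p / (2 * m)) ^ n :=
    (worstTvDist_nonneg _ _ n).trans
      (dominatedStar_worstTvDist_le_oneSided κ φ hm ht0 ht1 hw0 hw1 hμ hμ1 hM hM0 hstat hp0 hp1 hdom hreg hc1 hc hcm n)
  have h := sepDist_le_of_minorization (P := fun y z : Fin (K + 1) → S =>
      t * ptGraphSwap μ (fun r : Fin m => (((0 : Fin (K + 1)), (κ r).succ) : Fin (K + 1) × Fin (K + 1))) φ y z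
        + (1 - t) * prodKernel w M y z) (fun z => tensorFun_pos hμ z) (a := 1 - (2 * (K : ℝ) + p) / p *
      (1 - t * c * p / (2 * m)) ^ n) (by linarith)
    (dominatedStar_kernelAt_ge κ φ hm ht0 ht1 hw0 hw1 hμ hμ1 hM hM0 hstat hp0 hp1 hdom hreg hc1 hc hcm n)
  linarith

/-- **`s(n) ≤ ε` AFTER `(2m/(tcp))·log((2K+p)/(pε))` STEPS** (`0 < t`): the whole-space Doeblin condition
`Pⁿ(x,·) ≥ (1−ε)·π̃` for the map-assisted hub with imperfect transports. [ours] -/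
theorem dominatedStar_sepDist_le_of_ge_log (hm : 1 ≤ m) (ht0 : 0 < t) (ht1 : t ≤ 1) (hw0 : ∀ k, 0 ≤ w k)
    (hw1 : ∑ k, w k = 1) (hμ : ∀ k x, 0 < μ k x) (hμ1 : ∀ k, ∑ u, μ k u = 1) (hM : ∀ k, IsRowStochastic (M k))
    (hM0 : ∀ u v, M 0 u v = μ 0 v) (hstat : ∀ k : Fin (K + 1), k ≠ 0 → ∀ v, ∑ u, μ k u * M k u v = μ k v)
    (hp0 : 0 < p) (hp1 : p ≤ 1) (hdom : ∀ r u, p * μ (κ r).succ (φ r u) ≤ μ 0 u) (hreg : 4 * t ≤ p * (1 - t) * w 0)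
    {c : ℕ} (hc1 : 1 ≤ c) (hc : ∀ p' : Fin K, c ≤ (univ.filter (fun r : Fin m => κ r = p')).card) (hcm : c ≤ m)
    {ε : ℝ} (hε : 0 < ε) {n : ℕ} (hn : 2 * (m : ℝ) / (t * c * p) * Real.log ((2 * (K : ℝ) + p) / (p * ε)) ≤ n) :
    sepDist (fun y z : Fin (K + 1) → S =>
          t * ptGraphSwap μ (fun r : Fin m => (((0 : Fin (K + 1)), (κ r).succ) : Fin (K + 1) × Fin (K + 1))) φ y z
          + (1 - t) * prodKernel w M y z) (tensorFun μ) n ≤ ε := by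
  have hmpos : (0 : ℝ) < m := Nat.cast_pos.mpr (by omega)
  have hcpos : (0 : ℝ) < c := Nat.cast_pos.mpr (by omega)
  have hcm' : (c : ℝ) ≤ m := by exact_mod_cast hcm
  refine (dominatedStar_sepDist_le κ φ hm ht0.le ht1 hw0 hw1 hμ hμ1 hM hM0 hstat hp0 hp1 hdom hreg hc1 hc hcm n).trans ?_
  have ha0 : 0 < t * c * p / (2 * m) := by positivity
  have ha1 : t * c * p / (2 * m) ≤ 1 := by
    rw [div_le_one (by positivity)]
    have h1 : t * c ≤ 1 * m := by nlinarith
    nlinarith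
  have hC : 0 < (2 * (K : ℝ) + p) / p := by positivity
  refine geom_le_of_ge_log ha0 ha1 hC hε ?_
  have e1 : 1 / (t * c * p / (2 * m)) = 2 * (m : ℝ) / (t * c * p) := by field_simp
  have e2 : (2 * (K : ℝ) + p) / p / ε = (2 * (K : ℝ) + p) / (p * ε) := by rw [div_div]
  rw [e1, e2]; exact hn

/-- `d(n) ≤ s(n)` for the scheme (Levin–Peres–Wilmer Lemma 6.16, from the tree). [ours] -/
theorem dominatedStar_worstTvDist_le_sepDist (ht0 : 0 ≤ t) (ht1 : t ≤ 1) (hw0 : ∀ k, 0 ≤ w k) (hw1 : ∑ k, w k = 1)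
    (hμ : ∀ k x, 0 < μ k x) (hμ1 : ∀ k, ∑ u, μ k u = 1) (hM : ∀ k, IsRowStochastic (M k)) (n : ℕ) :
    worstTvDist (fun y z : Fin (K + 1) → S =>
          t * ptGraphSwap μ (fun r : Fin m => (((0 : Fin (K + 1)), (κ r).succ) : Fin (K + 1) × Fin (K + 1))) φ y z
          + (1 - t) * prodKernel w M y z) (tensorFun μ) n
      ≤ sepDist (fun y z : Fin (K + 1) → S =>
          t * ptGraphSwap μ (fun r : Fin m => (((0 : Fin (K + 1)), (κ r).succ) : Fin (K + 1) × Fin (K + 1))) φ y z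
          + (1 - t) * prodKernel w M y z) (tensorFun μ) n := by
  have hP := weightedScheme_isRowStochastic (t := t) (w := w)
    (ptGraphSwap_isRowStochastic (e := fun r : Fin m => (((0 : Fin (K + 1)), (κ r).succ) : Fin (K + 1) × Fin (K + 1)))
      (φ := φ) hμ) hM hw0 hw1 ht0 ht1
  exact LevinPeres2017_lemma_6_16_worst hP (fun z => (tensorFun_pos hμ z).le) (sum_tensorFun_eq_one _ hμ1) n

/-! ## §2 Perfect transports: arbitrary laws, maps and update weights -/

/-- **`Pⁿ(x,z) ≥ (1 − 2(K+1)(1 − t(1−t)w_0c/(2m))ⁿ)·π̃(z)`** with perfect transports `μ_{l_r}(φ_r u) = μ_0(u)`,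
`0 < t < 1`, `w_0 > 0`, every `x`, `z`, `n`. [ours] -/
theorem perfectStar_kernelAt_ge (hm : 1 ≤ m) (ht0 : 0 < t) (ht1 : t < 1) (hw0 : ∀ k, 0 ≤ w k) (hw00 : 0 < w 0)
    (hw1 : ∑ k, w k = 1) (hμ : ∀ k x, 0 < μ k x) (hμ1 : ∀ k, ∑ u, μ k u = 1) (hM : ∀ k, IsRowStochastic (M k))
    (hM0 : ∀ u v, M 0 u v = μ 0 v) (hstat : ∀ k : Fin (K + 1), k ≠ 0 → ∀ v, ∑ u, μ k u * M k u v = μ k v)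
    (hperf : ∀ r u, μ (κ r).succ (φ r u) = μ 0 u)
    {c : ℕ} (hc1 : 1 ≤ c) (hc : ∀ p' : Fin K, c ≤ (univ.filter (fun r : Fin m => κ r = p')).card) (hcm : c ≤ m)
    (n : ℕ) (x z : Fin (K + 1) → S) :
    (1 - 2 * ((K : ℝ) + 1) * (1 - t * (1 - t) * w 0 * c / (2 * m)) ^ n) * tensorFun μ z
      ≤ kernelAt (fun y z : Fin (K + 1) → S =>
          t * ptGraphSwap μ (fun r : Fin m => (((0 : Fin (K + 1)), (κ r).succ) : Fin (K + 1) × Fin (K + 1))) φ y z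
          + (1 - t) * prodKernel w M y z) n x z := by
  set α : Fin m → (Fin (K + 1) → S) → ℝ :=
    fun r z => min 1 (tensorFun μ (edgeFlowSwap (φ r) 0 (κ r).succ z) / tensorFun μ z) with hα_def
  have hα : ∀ r z, α r z = min 1 (tensorFun μ (edgeFlowSwap (φ r) 0 (κ r).succ z) / tensorFun μ z) := fun _ _ => rfl
  set β : Fin m → (Fin (K + 1) → S) → ℝ := fun r z => (1 : ℝ) * μ (κ r).succ (φ r (z 0)) / μ 0 (z 0) with hβ_def
  have hβ : ∀ r z, β r z = (1 : ℝ) * μ (κ r).succ (φ r (z 0)) / μ 0 (z 0) := fun _ _ => rfl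
  set β' : Fin m → (Fin (K + 1) → S) → ℝ :=
    fun r z => (1 : ℝ) * μ 0 ((φ r).symm (z (κ r).succ)) / μ (κ r).succ (z (κ r).succ) with hβ'_def
  have hβ' : ∀ r z, β' r z = (1 : ℝ) * μ 0 ((φ r).symm (z (κ r).succ)) / μ (κ r).succ (z (κ r).succ) :=
    fun _ _ => rfl
  set γ : Fin m → (Fin (K + 1) → S) × Finset (Fin (K + 1)) → ℝ := fun r a =>
    if (0 : Fin (K + 1)) ∉ a.2 then (if (κ r).succ ∉ a.2 then α r a.1 else β r a.1)
      else (if (κ r).succ ∉ a.2 then β' r a.1 else 0) with hγ_def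
  have hγ : ∀ r a, γ r a = if (0 : Fin (K + 1)) ∉ a.2 then (if (κ r).succ ∉ a.2 then α r a.1 else β r a.1)
      else (if (κ r).succ ∉ a.2 then β' r a.1 else 0) := fun _ _ => rfl
  set gbar : Fin m → Finset (Fin (K + 1)) → ℝ := fun r D =>
    if (0 : Fin (K + 1)) ∉ D then (if (κ r).succ ∉ D then (1 : ℝ) else (1 : ℝ))
      else (if (κ r).succ ∉ D then (1 : ℝ) else 0) with hg_def
  have hg : ∀ r D, gbar r D = if (0 : Fin (K + 1)) ∉ D then (if (κ r).succ ∉ D then (1 : ℝ) else (1 : ℝ))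
      else (if (κ r).succ ∉ D then (1 : ℝ) else 0) := fun _ _ => rfl
  set Bset : Fin m → Finset (Fin (K + 1)) → Finset (Fin (K + 1)) := fun r D =>
    if (0 : Fin (K + 1)) ∉ D ∧ (κ r).succ ∉ D then D else insert (0 : Fin (K + 1)) (insert (κ r).succ D) with hB_def
  have hB : ∀ r D, Bset r D = if (0 : Fin (K + 1)) ∉ D ∧ (κ r).succ ∉ D then D
      else insert (0 : Fin (K + 1)) (insert (κ r).succ D) := fun _ _ => rfl
  set Ph : (Fin (K + 1) → S) × Finset (Fin (K + 1)) → (Fin (K + 1) → S) × Finset (Fin (K + 1)) → ℝ := fun a b =>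
    ∑ r : Fin m, t / m *
        (γ r a * (if b.1 = edgeFlowSwap (φ r) 0 (κ r).succ a.1 ∧ b.2 = a.2.image (Equiv.swap (0 : Fin (K + 1)) (κ r).succ)
            then (1 : ℝ) else 0)
          + (α r a.1 - γ r a) * (if b.1 = edgeFlowSwap (φ r) 0 (κ r).succ a.1 ∧ b.2 = Bset r a.2 then (1 : ℝ) else 0)
          + (1 - α r a.1) * (if b.1 = a.1 ∧ b.2 = Bset r a.2 then (1 : ℝ) else 0))
      + (1 - t) * ∑ k : Fin (K + 1), w k * (coordKernel M k a.1 b.1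
          * (if b.2 = (if k = 0 then a.2.erase 0 else a.2) then (1 : ℝ) else 0)) with hPh_def
  have hPh : ∀ a b, Ph a b = ∑ r : Fin m, t / m *
        (γ r a * (if b.1 = edgeFlowSwap (φ r) 0 (κ r).succ a.1 ∧ b.2 = a.2.image (Equiv.swap (0 : Fin (K + 1)) (κ r).succ)
            then (1 : ℝ) else 0)
          + (α r a.1 - γ r a) * (if b.1 = edgeFlowSwap (φ r) 0 (κ r).succ a.1 ∧ b.2 = Bset r a.2 then (1 : ℝ) else 0)
          + (1 - α r a.1) * (if b.1 = a.1 ∧ b.2 = Bset r a.2 then (1 : ℝ) else 0))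
      + (1 - t) * ∑ k : Fin (K + 1), w k * (coordKernel M k a.1 b.1
          * (if b.2 = (if k = 0 then a.2.erase 0 else a.2) then (1 : ℝ) else 0)) := fun _ _ => rfl
  set Q : Finset (Fin (K + 1)) → Finset (Fin (K + 1)) → ℝ := fun D D' => ∑ r : Fin m, t / m *
        (gbar r D * (if D' = D.image (Equiv.swap (0 : Fin (K + 1)) (κ r).succ) then (1 : ℝ) else 0)
          + (1 - gbar r D) * (if D' = Bset r D then (1 : ℝ) else 0))
      + (1 - t) * (w 0 * (if D' = D.erase 0 then (1 : ℝ) else 0) + (1 - w 0) * (if D' = D then (1 : ℝ) else 0)) with hQ_def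
  have hQ : ∀ D D', Q D D' = ∑ r : Fin m, t / m *
        (gbar r D * (if D' = D.image (Equiv.swap (0 : Fin (K + 1)) (κ r).succ) then (1 : ℝ) else 0)
          + (1 - gbar r D) * (if D' = Bset r D then (1 : ℝ) else 0))
      + (1 - t) * (w 0 * (if D' = D.erase 0 then (1 : ℝ) else 0) + (1 - w 0) * (if D' = D then (1 : ℝ) else 0)) :=
    fun _ _ => rfl
  have hw01 : w 0 ≤ 1 := by
    have h := Finset.single_le_sum (f := w) (fun k _ => hw0 k) (mem_univ (0 : Fin (K + 1)))
    rw [hw1] at h; exact h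
  have hdom : ∀ r u, (1 : ℝ) * μ (κ r).succ (φ r u) ≤ μ 0 u := fun r u => by rw [one_mul, hperf]
  have hrev : ∀ r u, (1 : ℝ) * μ 0 u ≤ μ (κ r).succ (φ r u) := fun r u => by rw [one_mul, hperf]
  have htag := regen_nonempty_le_perfect κ hm ht0 ht1 hw00 hw01 rfl rfl hg hB hQ hc1 hc hcm n
  have hQst := regen_isRowStochastic κ hm ht0.le ht1.le hw00.le hw01 zero_le_one le_rfl zero_le_one le_rfl hg hQ
  have hmassQ : ∑ D, lawAt Q (Pi.single (univ : Finset (Fin (K + 1))) 1) n D = 1 := by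
    rw [sum_lawAt hQst, Finset.sum_pi_single', if_pos (mem_univ _)]
  have hsplit := Finset.sum_filter_add_sum_filter_not univ (fun D : Finset (Fin (K + 1)) => D ≠ ∅)
    (fun D => lawAt Q (Pi.single (univ : Finset (Fin (K + 1))) 1) n D)
  have hE : univ.filter (fun D : Finset (Fin (K + 1)) => ¬D ≠ ∅) = {∅} := by
    ext D; simp only [Finset.mem_filter, Finset.mem_univ, true_and, not_not, Finset.mem_singleton]
  rw [hmassQ, hE, Finset.sum_singleton] at hsplit
  have hmin := dom_minorization κ φ hm ht0.le ht1.le hw0 hw1 hμ hμ1 hM hM0 hstat zero_le_one zero_le_one hdom hrev hα hβ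
    hβ' hγ hg hB hPh hQ x n z
  have hπ0 : 0 ≤ tensorFun μ z := (tensorFun_pos hμ z).le
  unfold kernelAt
  calc (1 - 2 * ((K : ℝ) + 1) * (1 - t * (1 - t) * w 0 * c / (2 * m)) ^ n) * tensorFun μ z
      ≤ lawAt Q (Pi.single (univ : Finset (Fin (K + 1))) 1) n ∅ * tensorFun μ z :=
        mul_le_mul_of_nonneg_right (by linarith) hπ0
    _ ≤ _ := hmin

/-- **THE SEPARATION CEILING WITH PERFECT TRANSPORTS: `s(n) ≤ 2(K+1)·(1 − t(1−t)w_0c/(2m))ⁿ`** (any laws, maps,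
weights; `0 < t < 1`, `w_0 > 0`). [ours] -/
theorem perfectStar_sepDist_le (hm : 1 ≤ m) (ht0 : 0 < t) (ht1 : t < 1) (hw0 : ∀ k, 0 ≤ w k) (hw00 : 0 < w 0)
    (hw1 : ∑ k, w k = 1) (hμ : ∀ k x, 0 < μ k x) (hμ1 : ∀ k, ∑ u, μ k u = 1) (hM : ∀ k, IsRowStochastic (M k))
    (hM0 : ∀ u v, M 0 u v = μ 0 v) (hstat : ∀ k : Fin (K + 1), k ≠ 0 → ∀ v, ∑ u, μ k u * M k u v = μ k v)
    (hperf : ∀ r u, μ (κ r).succ (φ r u) = μ 0 u)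
    {c : ℕ} (hc1 : 1 ≤ c) (hc : ∀ p' : Fin K, c ≤ (univ.filter (fun r : Fin m => κ r = p')).card) (hcm : c ≤ m)
    (n : ℕ) :
    sepDist (fun y z : Fin (K + 1) → S =>
          t * ptGraphSwap μ (fun r : Fin m => (((0 : Fin (K + 1)), (κ r).succ) : Fin (K + 1) × Fin (K + 1))) φ y z
          + (1 - t) * prodKernel w M y z) (tensorFun μ) n
      ≤ 2 * ((K : ℝ) + 1) * (1 - t * (1 - t) * w 0 * c / (2 * m)) ^ n := by
  have hbound : 0 ≤ 2 * ((K : ℝ) + 1) * (1 - t * (1 - t) * w 0 * c / (2 * m)) ^ n :=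
    (worstTvDist_nonneg _ _ n).trans
      (perfectStar_worstTvDist_le κ φ hm ht0 ht1 hw0 hw00 hw1 hμ hμ1 hM hM0 hstat hperf hc1 hc hcm n)
  have h := sepDist_le_of_minorization (P := fun y z : Fin (K + 1) → S =>
      t * ptGraphSwap μ (fun r : Fin m => (((0 : Fin (K + 1)), (κ r).succ) : Fin (K + 1) × Fin (K + 1))) φ y z
        + (1 - t) * prodKernel w M y z) (fun z => tensorFun_pos hμ z) (a := 1 - 2 * ((K : ℝ) + 1) *
      (1 - t * (1 - t) * w 0 * c / (2 * m)) ^ n) (by linarith)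
    (perfectStar_kernelAt_ge κ φ hm ht0 ht1 hw0 hw00 hw1 hμ hμ1 hM hM0 hstat hperf hc1 hc hcm n)
  linarith

/-- **`s(n) ≤ ε` AFTER `(2m/(t(1−t)w_0c))·log(2(K+1)/ε)` STEPS** with perfect transports. [ours] -/
theorem perfectStar_sepDist_le_of_ge_log (hm : 1 ≤ m) (ht0 : 0 < t) (ht1 : t < 1) (hw0 : ∀ k, 0 ≤ w k)
    (hw00 : 0 < w 0) (hw1 : ∑ k, w k = 1) (hμ : ∀ k x, 0 < μ k x) (hμ1 : ∀ k, ∑ u, μ k u = 1)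
    (hM : ∀ k, IsRowStochastic (M k)) (hM0 : ∀ u v, M 0 u v = μ 0 v)
    (hstat : ∀ k : Fin (K + 1), k ≠ 0 → ∀ v, ∑ u, μ k u * M k u v = μ k v) (hperf : ∀ r u, μ (κ r).succ (φ r u) = μ 0 u)
    {c : ℕ} (hc1 : 1 ≤ c) (hc : ∀ p' : Fin K, c ≤ (univ.filter (fun r : Fin m => κ r = p')).card) (hcm : c ≤ m)
    {ε : ℝ} (hε : 0 < ε) {n : ℕ} (hn : 2 * (m : ℝ) / (t * (1 - t) * w 0 * c) * Real.log (2 * ((K : ℝ) + 1) / ε) ≤ n) :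
    sepDist (fun y z : Fin (K + 1) → S =>
          t * ptGraphSwap μ (fun r : Fin m => (((0 : Fin (K + 1)), (κ r).succ) : Fin (K + 1) × Fin (K + 1))) φ y z
          + (1 - t) * prodKernel w M y z) (tensorFun μ) n ≤ ε := by
  have hmpos : (0 : ℝ) < m := Nat.cast_pos.mpr (by omega)
  have hcpos : (0 : ℝ) < c := Nat.cast_pos.mpr (by omega)
  have hcm' : (c : ℝ) ≤ m := by exact_mod_cast hcm
  have h1t : 0 < 1 - t := by linarith
  have hw01 : w 0 ≤ 1 := by
    have h := Finset.single_le_sum (f := w) (fun k _ => hw0 k) (mem_univ (0 : Fin (K + 1)))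
    rw [hw1] at h; exact h
  refine (perfectStar_sepDist_le κ φ hm ht0 ht1 hw0 hw00 hw1 hμ hμ1 hM hM0 hstat hperf hc1 hc hcm n).trans ?_
  have ha0 : 0 < t * (1 - t) * w 0 * c / (2 * m) := by positivity
  have ha1 : t * (1 - t) * w 0 * c / (2 * m) ≤ 1 := by
    rw [div_le_one (by positivity)]
    have h1 : t * (1 - t) ≤ 1 := by nlinarith
    have h2 : t * (1 - t) * w 0 ≤ 1 := by nlinarith
    nlinarith
  have hC : 0 < 2 * ((K : ℝ) + 1) := by positivity
  refine geom_le_of_ge_log ha0 ha1 hC hε ?_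
  have e1 : 1 / (t * (1 - t) * w 0 * c / (2 * m)) = 2 * (m : ℝ) / (t * (1 - t) * w 0 * c) := by field_simp
  rw [e1]; exact hn

end Sep

end Summit.Ventures.LatticeQCDFlow.Scaling

end
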